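import Mathlib

/-!
# Federbush 1986/1987 — the ABELIAN STABILITY THEOREM for Bałaban block averaging: «averaging decreases the action», PROVED

**Citation header (reproduction of PUBLISHED work; literature seat `b2b-balaban-t4-lit2` of the Bałaban lattice
Yang–Mills cell `pub-balaban`, file `t4/T4-LIT2-CITABLE-NE.md` §1.2 (a) / §3 (L-1); CITED-FACTS S-t4lit2g1-1 and S-t4lit2g1-2).**
P. Federbush, *A phase cell approach to Yang–Mills theory. I. Modes, lattice-continuum duality*, Commun. Math. Phys.
**107** (1986) 319–329 [Federbush1986PhaseCellI], p. 321 ('Abelian Stability Theorem', (0.12)), pp. 322–323 ((1.3)–(1.9));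
P. Federbush, *A phase cell approach to Yang–Mills theory. III. Local stability, modified renormalization group
transformation*, Commun. Math. Phys. **110** (1987) 293–309 [Federbush1987PhaseCellIII], §2 p. 296 ((2.1)–(2.5)).  Page images
read by the seat: `HOME/t4/b2b-balaban-t4-lit2/renders/fed1986/fed1986-cmp107-p003/p004/p005-x2.png` (pp. 321, 322, 323) and
`…/renders/fed1987III/fed1987-cmp110-III-p004-x2.png` (p. 296) — every display below was read as an image.  Federbush's papers
are PUBLISHED LITERATURE outside the series under audit (Bałaban CMP 1982–89); nothing here asserts anything about those papers.

**What Federbush prints (verbatim).**  I p. 321: *"One has an elegant stability theorem. **Abelian Stability Theorem.** For any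
set of compatible assignments to the lattices, the Wilson Actions are a monotonically decreasing function of the length scale.
That is, averaging decreases the action. We will write S^r_0 for the action at length scale l_r = 1/2^r. Then we have
S^r_0 ≥ S^s_0 if r > s. (0.12)"* (setting, same page: lattices ℒ^r = (2^{−r}ℤ)⁴, real-valued bond assignments A(e) with
A(−e) = −A(e), *"Averaging (we refer to as Balaban averaging) is defined in Eq. (1.8) of [1]"*, [1] = Bałaban, CMP 95 (1984);
a COMPATIBLE family = one whose assignments on every lattice are the averages of those on every finer lattice).  I p. 322:
*"A_{∂P_i} = Σ_j α(i)_j A_{∂p_j} (1.4) for non-negative numbers α(i)_j"* (P_i the plaquettes at level r, p_j at level r + 1;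
obtained from the loop-averaging identity (1.3)).  I p. 323: *"**Proof of the Abelian Stability Theorem.** The α(i)_j above satisfy
Σ_i α(i)_j = 1/2², (1.5) Σ_j α(i)_j = 2². (1.6) By the Schwarz inequality and (1.4) and (1.6) it follows that
(A_{∂P_i})² ≤ 2² Σ_j α(i)_j (A_{∂p_j})², (1.7) and summing over i using (1.5) Σ_i (A_{∂P_i})² ≤ Σ_j (A_{∂p_j})², (1.8) and
thus S^r_0 ≤ S^{r+1}_0. (1.9)"*.  III p. 296 (block N⁴ instead of 2⁴, general d): *"There are non-negative numbers α(i)_j such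
that (with g_{∂P} = e^{A_{∂P}}) A_{∂P_i} = Σ_j α(i)_j A_{∂p_j}, (2.1) with Σ_i α(i)_j = 1/N², (2.2) and Σ_j α(i)_j = N². (2.3)
By convexity or by the Schwartz inequality it follows from (2.1) and (2.3) that (A_{∂P_i})² ≤ N² Σ_j α(i)_j (A_{∂p_j})², (2.4) and
from (2.2) that Σ_i (A_{∂P_i})² ≤ Σ_j (A_{∂p_j})². (2.5) In d dimensions 1/N² in (2.2) would be replaced by 1/N^{d−2}, and in (2.5)
there would be a factor N^{4−d} on the right side of the inequality."*

**What this file PROVES (kernel, Mathlib only; every constant explicit; no hypothesis beyond the printed ones).**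
* §1 `sum_sq_weightedSum_le` — the abstract content of (1.4)–(1.8)/(2.1)–(2.5): for finitely many "coarse" indices i and
  "fine" indices j, non-negative weights α with row sums ≤ R (Federbush: = N², (1.6)/(2.3)) and column sums ≤ C (Federbush:
  = N^{2−d}, (1.5)/(2.2)), and ANY real fine data a, Σ_i (Σ_j α i j · a j)² ≤ R·C·Σ_j (a j)² — Cauchy–Schwarz row by row
  ((1.7)/(2.4)), then the column-sum bound ((1.8)/(2.5)).  Federbush's equalities are weakened to inequalities (free).
* §2 `wilsonAction_coarse_le_fine` — the scale bookkeeping behind «In d dimensions … a factor N^{4−d}»: with the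
  (non-compact abelian) Wilson action at lattice spacing ε written S_ε = ε^{d−4} Σ_p (A_{∂p})² (so that A_{∂p} ≈ ε²F and
  S ≈ ∫F²), row sums N², column sums N^{2−d}, N > 0, ε > 0:  (Nε)^{d−4} Σ_i (A_{∂P_i})² ≤ ε^{d−4} Σ_j (A_{∂p_j})², i.e.
  S^{coarse} ≤ S^{fine} — (1.9)/(2.5) in every dimension d.  (In d = 4 the prefactors are 1 and this is (1.8) literally:
  `sum_sq_coarse_le_sum_sq_fine_dim4`.)
* §3 `exists_tendsto_of_forall_le_succ` — the use Federbush makes of monotonicity along a compatible family («monotonically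
  increase to the continuum action», abstract): a real sequence with S r ≤ S (r+1) for all r and bounded above converges, to a
  limit dominating every term.  [folklore]
* §4 `sInf_coarse_le_sInf_fine` — a COROLLARY NOT PRINTED BY FEDERBUSH, recorded for the cell's node U1b (T4-DAG §6 NE3,
  abelian rung; `t4/T4-LIT2-CITABLE-NE.md` §1.2 (a) "[reading]"): if an averaging map sends fine admissible configurations to
  coarse admissible ones and does not increase the action, then the coarse constrained infimum is ≤ the fine constrained
  infimum — for Bałaban's constrained minimisers in the abelian linear model this reads inf_k ≤ inf_{k+1} (minimal actions
  monotone in the number of steps).  Pure order theory on `sInf`; [folklore].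
* §6 (v1.1) `loopAverage`, `stencilWeight`, `loopAverage_eq_sum`, `sum_stencilWeight_row`, `sum_stencilWeight_col`,
  `wilsonAction_loopAverage_le` — THE COMBINATORIAL INPUT DERIVED: Federbush's closed-loop average (1.3) p. 322 for Γ = a
  coarse plaquette (abelian Stokes form: average over the N^d base points of a block of the sums of the N² fine plaquettes
  inside the translated coarse plaquette), the weights α(i)_j of (1.4) DEFINED from it by counting, their non-negativity,
  and the sum rules (1.6)/(2.3) (row = N²) and (1.5)/(2.2) (column = N^{2−d}) PROVED as counting identities for an arbitrary
  block map with N^d-point blocks — hence the Abelian Stability Theorem for the EXPLICIT average, every d.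
* §7 (v1.1) `torusBlock`, `card_block_torusBlock`, `torusSquareOffsets`, `wilsonAction_torusLoopAverage_le` — the standard
  CONTIGUOUS blocks (cubes of side N) of the discrete torus (ℤ/nNℤ)^d have N^d points (via `finProdFinEquiv`) and the
  N × N offset square has N² points: the final statement with NO hypothesis left except ε > 0 (d = k + 2 ≥ 2, N, n ≥ 1).
* §8 (v1.2) `sum_sq_meanLoopAverage_le`, `sum_sq_meanTorusLoopAverage_le`, `sum_sq_le_csInf_fibre`,
  `sum_sq_le_of_rightInverse`, `torus_sum_sq_le_of_rightInverse` — the B5 / BIJ85 NORMALISATION (η = N⁻¹; Bałaban's average is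
  a MEAN along the contour, BIJ85 (2.13) p. 304 / p. 309 «Q_k = (Q)^k … (2.13), where L is replaced by L^k»): Σ_c (η·loopAverage
  F)(c)² ≤ η^{d−2} Σ_w F(w)², read as ‖∂₁(Q_kA)‖² ≤ ‖∂A‖²_η for abelian bond fields, and — in fibre-infimum and right-inverse
  (minimiser) form — as the CURL HALF ⟨B, Δ_kB⟩ ≥ ‖∂₁B‖² of the k-uniform coercivity of the VARIATIONAL effective gauge action
  (B5 (1.65)/(1.67) lower bound with the sharp γ₀ = 1; BIJ85 (4.3.1)–(4.3.2), (4.1.5), Thm 7.1.1 p. 325 «bounded below by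
  ε‖∂B‖² (see also [6I, 8])», [8] = Federbush I).  The identifications (variational Δ_k; plaquette-of-average = η·loop average)
  are QUOTED in the §8 header, not re-derived for the tree's typed B5 operators.

SCOPE / WHAT IS NOT HERE.  §1–§2 take the weights as data with the printed sum rules as hypotheses, exactly as the printed
proof does from (1.4) on; v1.1 (§6–§7) DERIVES that input for the abelian Stokes form of Federbush's one-step loop average
(1.3) with contiguous blocks on the discrete torus (weights defined by counting; row sums = N², column sums = N^{2−d},
proved).  What stays QUOTED, not derived: Federbush's identification of (1.3) with Bałaban's averaging (1.8) of CMP 95 on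
closed loops (I p. 322 'Plaquette Averaging – Closed Loop Averaging') — resp. with the tree's `Setup.Averaging` in the
abelian linearisation (the printed linearised identity is Bałaban, CMP 98 (1985) (48) p. 25).  NORMALISATION NOTE (v1.1,
after the cross-read C-adv8-58, advisories A1/A2): Federbush prints NO display defining S^r_0 (pp. 319–323); the prefactor
ε^{d−4} of `wilsonActionAbelian` and the omitted ½ are THIS FILE's normalisation (standard Wilson scaling), inert for every
inequality proved here; III §2's displays (2.1)–(2.5) stand under the heading 'Pure Small Field Stability' with the closing
sentence «In this paper we understand a relation that holds in the "small field" region to mean a relation that is true to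
linear order in deviations of Lie Algebra elements from zero» — for the ABELIAN real-valued model of I they are exact, and
only that abelian content is formalised.  Non-abelian fields: Federbush's one-step comparison
for his MODIFIED action/average is III Local Stability Theorems 4.1–4.3 p. 299 (cubic defect −f₂(Σ|A_{∂p_j}|²)^{3/2}) — not
formalised.  HONEST FRAMING: a reproduced published inequality about ABELIAN lattice gauge fields; it is not an η-rate, says
nothing about Bałaban's d = 4 non-abelian minimisers, and is NOT progress on the cell's summit (rung (B)+1 ≠ infinite volume /
mass gap / Clay).
-/

namespace Literature.MathematicalPhysics.QuantumFieldTheory.Federbush1986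

open Finset Filter Topology

/-! ## §1 The doubly-weighted Cauchy–Schwarz inequality = Federbush I (1.7)–(1.8) / III (2.4)–(2.5), abstract -/

section Weighted

variable {ι κ : Type*} [Fintype ι] [Fintype κ]

/-- ONE ROW, Federbush I (1.7) / III (2.4): for non-negative weights `α j` with `Σ_j α j ≤ R`,
`(Σ_j α j · a j)² ≤ R · Σ_j α j · (a j)²` ("By convexity or by the Schwartz inequality").
[cite: Federbush1986PhaseCellI, (1.7) p. 323; Federbush1987PhaseCellIII, (2.4) p. 296] -/
theorem sq_weightedSum_le_row (α a : κ → ℝ) (R : ℝ) (hα : ∀ j, 0 ≤ α j) (hrow : ∑ j, α j ≤ R) :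
    (∑ j, α j * a j) ^ 2 ≤ R * ∑ j, α j * a j ^ 2 := by
  -- Cauchy–Schwarz with f j = √(α j), g j = √(α j) · a j
  have hcs := Finset.sum_mul_sq_le_sq_mul_sq (Finset.univ : Finset κ)
    (fun j => Real.sqrt (α j)) (fun j => Real.sqrt (α j) * a j)
  have hfg : ∀ j, Real.sqrt (α j) * (Real.sqrt (α j) * a j) = α j * a j := by
    intro j
    rw [← mul_assoc, Real.mul_self_sqrt (hα j)]
  have hf2 : ∀ j, Real.sqrt (α j) ^ 2 = α j := fun j => Real.sq_sqrt (hα j)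
  have hg2 : ∀ j, (Real.sqrt (α j) * a j) ^ 2 = α j * a j ^ 2 := by
    intro j
    rw [mul_pow, Real.sq_sqrt (hα j)]
  simp only [hfg, hf2, hg2] at hcs
  have hnonneg : 0 ≤ ∑ j, α j * a j ^ 2 :=
    Finset.sum_nonneg fun j _ => mul_nonneg (hα j) (sq_nonneg _)
  calc (∑ j, α j * a j) ^ 2 ≤ (∑ j, α j) * ∑ j, α j * a j ^ 2 := hcs
    _ ≤ R * ∑ j, α j * a j ^ 2 := mul_le_mul_of_nonneg_right hrow hnonneg

/-- FEDERBUSH'S ABELIAN STABILITY INEQUALITY, abstract form of I (1.4)–(1.8) / III (2.1)–(2.5): non-negative weights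
`α i j` with ROW sums `Σ_j α i j ≤ R` (printed: `= N²`, (1.6)/(2.3)) and COLUMN sums `Σ_i α i j ≤ C` (printed: `= N^{2−d}`,
(1.5)/(2.2)); then for every real fine datum `a`, `Σ_i (Σ_j α i j · a j)² ≤ R · C · Σ_j (a j)²` — i.e. with
`A_{∂P_i} = Σ_j α(i)_j A_{∂p_j}` (1.4), `Σ_i (A_{∂P_i})² ≤ N^{4−d} Σ_j (A_{∂p_j})²`.
[cite: Federbush1986PhaseCellI, 'Abelian Stability Theorem' (0.12) p. 321, proof (1.5)–(1.8) p. 323;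
Federbush1987PhaseCellIII, §2 (2.1)–(2.5) p. 296] -/
theorem sum_sq_weightedSum_le (α : ι → κ → ℝ) (a : κ → ℝ) (R C : ℝ) (hα : ∀ i j, 0 ≤ α i j)
    (hrow : ∀ i, ∑ j, α i j ≤ R) (hcol : ∀ j, ∑ i, α i j ≤ C) (hR : 0 ≤ R) :
    ∑ i, (∑ j, α i j * a j) ^ 2 ≤ R * C * ∑ j, a j ^ 2 := by
  -- row by row (1.7)/(2.4)
  have hrows : ∑ i, (∑ j, α i j * a j) ^ 2 ≤ ∑ i, R * ∑ j, α i j * a j ^ 2 :=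
    Finset.sum_le_sum fun i _ => sq_weightedSum_le_row (α i) a R (hα i) (hrow i)
  -- exchange the sums and use the column bound (1.5)/(2.2)
  have hswap : ∑ i, R * ∑ j, α i j * a j ^ 2 = R * ∑ j, (∑ i, α i j) * a j ^ 2 := by
    rw [← Finset.mul_sum, Finset.sum_comm]
    congr 1
    refine Finset.sum_congr rfl fun j _ => ?_
    rw [Finset.sum_mul]
  have hcols : ∑ j, (∑ i, α i j) * a j ^ 2 ≤ ∑ j, C * a j ^ 2 :=
    Finset.sum_le_sum fun j _ => mul_le_mul_of_nonneg_right (hcol j) (sq_nonneg _)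
  calc ∑ i, (∑ j, α i j * a j) ^ 2 ≤ ∑ i, R * ∑ j, α i j * a j ^ 2 := hrows
    _ = R * ∑ j, (∑ i, α i j) * a j ^ 2 := hswap
    _ ≤ R * ∑ j, C * a j ^ 2 := mul_le_mul_of_nonneg_left hcols hR
    _ = R * C * ∑ j, a j ^ 2 := by rw [← Finset.mul_sum, mul_assoc]

/-- Federbush I (1.8) literally (d = 4, block 2⁴: row sums `2²`, column sums `1/2²`; or block N⁴ with `N²`, `1/N²` as in III
(2.2)–(2.3)): `Σ_i (A_{∂P_i})² ≤ Σ_j (A_{∂p_j})²` — in four dimensions the abelian Wilson action `Σ_p (A_{∂p})²` is scale free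
and DECREASES under one Bałaban averaging step.
[cite: Federbush1986PhaseCellI, (1.8)–(1.9) p. 323; Federbush1987PhaseCellIII, (2.5) p. 296] -/
theorem sum_sq_coarse_le_sum_sq_fine_dim4 (α : ι → κ → ℝ) (a : κ → ℝ) {N : ℝ} (hN : 0 < N)
    (hα : ∀ i j, 0 ≤ α i j) (hrow : ∀ i, ∑ j, α i j ≤ N ^ 2) (hcol : ∀ j, ∑ i, α i j ≤ (N ^ 2)⁻¹) :
    ∑ i, (∑ j, α i j * a j) ^ 2 ≤ ∑ j, a j ^ 2 := by
  have h := sum_sq_weightedSum_le α a (N ^ 2) ((N ^ 2)⁻¹) hα hrow hcol (by positivity)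
  have hN2 : (N ^ 2) * (N ^ 2)⁻¹ = 1 := mul_inv_cancel₀ (by positivity)
  simpa [hN2] using h

end Weighted

/-! ## §2 The scale bookkeeping: «a factor N^{4−d}» and the Wilson-action prefactor ε^{d−4} -/

section Scales

variable {ι κ : Type*} [Fintype ι] [Fintype κ]

/-- The (non-compact abelian) Wilson action of a family of plaquette variables `A_{∂p}` at lattice spacing `ε` in `d`
dimensions, in the normalisation `S_ε = ε^{d−4} Σ_p (A_{∂p})²` (so that with `A_{∂p} ≈ ε² F(p)` one has `S_ε ≈ Σ_p ε^d F(p)²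
≈ ∫ F²`; Federbush I p. 319 "The Wilson actions likewise approach the continuum action ½∫(dA)²" — the overall constant ½ is
immaterial and omitted). [folklore] -/
noncomputable def wilsonActionAbelian (d : ℕ) (ε : ℝ) (A : κ → ℝ) : ℝ :=
  ε ^ ((d : ℤ) - 4) * ∑ p, A p ^ 2

/-- Unfolding lemma for `wilsonActionAbelian`. [folklore] -/
theorem wilsonActionAbelian_def (d : ℕ) (ε : ℝ) (A : κ → ℝ) :
    wilsonActionAbelian d ε A = ε ^ ((d : ℤ) - 4) * ∑ p, A p ^ 2 := rfl

/-- In four dimensions the prefactor is `1`: `S_ε = Σ_p (A_{∂p})²`. [folklore] -/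
theorem wilsonActionAbelian_dim4 (ε : ℝ) (A : κ → ℝ) :
    wilsonActionAbelian 4 ε A = ∑ p, A p ^ 2 := by
  simp [wilsonActionAbelian]

/-- FEDERBUSH'S ABELIAN STABILITY THEOREM, one averaging step, every dimension `d` (III p. 296: "In d dimensions 1/N² in
(2.2) would be replaced by 1/N^{d−2}, and in (2.5) there would be a factor N^{4−d} on the right side of the inequality"):
coarse spacing `N·ε`, fine spacing `ε`, coarse plaquette variables `A_{∂P_i} = Σ_j α(i)_j A_{∂p_j}` with non-negative weights of
row sums `≤ N²` and column sums `≤ N^{2−d}`; then `S_{Nε}(coarse) ≤ S_ε(fine)` — «averaging decreases the action».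
[cite: Federbush1986PhaseCellI, 'Abelian Stability Theorem' (0.12) p. 321 and (1.9) p. 323;
Federbush1987PhaseCellIII, §2 (2.1)–(2.5) p. 296] -/
theorem wilsonAction_coarse_le_fine (d : ℕ) {N ε : ℝ} (hN : 0 < N) (hε : 0 < ε)
    (α : ι → κ → ℝ) (a : κ → ℝ) (hα : ∀ i j, 0 ≤ α i j)
    (hrow : ∀ i, ∑ j, α i j ≤ N ^ 2) (hcol : ∀ j, ∑ i, α i j ≤ N ^ (2 - (d : ℤ))) :
    wilsonActionAbelian d (N * ε) (fun i => ∑ j, α i j * a j) ≤ wilsonActionAbelian d ε a := by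
  have hNne : N ≠ 0 := hN.ne'
  have hεne : ε ≠ 0 := hε.ne'
  -- §1 with R = N², C = N^{2−d}:  Σ_i (…)² ≤ N² · N^{2−d} · Σ_j a_j²
  have h1 := sum_sq_weightedSum_le α a (N ^ 2) (N ^ (2 - (d : ℤ))) hα hrow hcol (by positivity)
  -- N² · N^{2−d} = N^{4−d}
  have hpow : (N ^ 2 : ℝ) * N ^ (2 - (d : ℤ)) = N ^ (4 - (d : ℤ)) := by
    rw [show (N ^ 2 : ℝ) = N ^ (2 : ℤ) by norm_cast, ← zpow_add₀ hNne]
    congr 1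
    ring
  rw [hpow] at h1
  unfold wilsonActionAbelian
  -- (Nε)^{d−4} = N^{d−4} ε^{d−4}, and N^{d−4} · N^{4−d} = 1
  have hprod : (N * ε) ^ ((d : ℤ) - 4) = N ^ ((d : ℤ) - 4) * ε ^ ((d : ℤ) - 4) := mul_zpow N ε _
  have hcancel : N ^ ((d : ℤ) - 4) * N ^ (4 - (d : ℤ)) = 1 := by
    rw [← zpow_add₀ hNne]
    have : ((d : ℤ) - 4) + (4 - (d : ℤ)) = 0 := by ring
    rw [this, zpow_zero]
  have hNpos : 0 < N ^ ((d : ℤ) - 4) := zpow_pos hN _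
  have hεpos : 0 < ε ^ ((d : ℤ) - 4) := zpow_pos hε _
  calc (N * ε) ^ ((d : ℤ) - 4) * ∑ i, (∑ j, α i j * a j) ^ 2
      = N ^ ((d : ℤ) - 4) * ε ^ ((d : ℤ) - 4) * ∑ i, (∑ j, α i j * a j) ^ 2 := by rw [hprod]
    _ ≤ N ^ ((d : ℤ) - 4) * ε ^ ((d : ℤ) - 4) * (N ^ (4 - (d : ℤ)) * ∑ j, a j ^ 2) := by
        exact mul_le_mul_of_nonneg_left h1 (by positivity)
    _ = (N ^ ((d : ℤ) - 4) * N ^ (4 - (d : ℤ))) * (ε ^ ((d : ℤ) - 4) * ∑ j, a j ^ 2) := by ring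
    _ = ε ^ ((d : ℤ) - 4) * ∑ j, a j ^ 2 := by rw [hcancel, one_mul]

end Scales

/-! ## §3 Along a compatible family: monotone and bounded ⇒ convergent («monotonically increase to the continuum action») -/

/-- If the actions along a compatible family satisfy `S r ≤ S (r+1)` for every level (the Abelian Stability Theorem, (0.12))
and are bounded above (Federbush bounds them by the continuum action of a smooth interpolant, I §2), then they converge, and
the limit dominates every `S r`.  [folklore] (Mathlib: `tendsto_atTop_ciSup`.) -/
theorem exists_tendsto_of_forall_le_succ (S : ℕ → ℝ) (hmono : ∀ r, S r ≤ S (r + 1))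
    (hbdd : BddAbove (Set.range S)) :
    ∃ ℓ : ℝ, Tendsto S atTop (𝓝 ℓ) ∧ ∀ r, S r ≤ ℓ := by
  have hm : Monotone S := monotone_nat_of_le_succ hmono
  exact ⟨⨆ r, S r, tendsto_atTop_ciSup hm hbdd, fun r => le_ciSup hbdd r⟩

/-- Federbush's form (0.12): `S^r ≥ S^s if r > s` from the one-step inequality. [cite: Federbush1986PhaseCellI, (0.12) p. 321] -/
theorem action_le_of_le_level (S : ℕ → ℝ) (hmono : ∀ r, S r ≤ S (r + 1)) {s r : ℕ} (h : s ≤ r) :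
    S s ≤ S r :=
  (monotone_nat_of_le_succ hmono) h

/-! ## §4 Constrained infima under an action-decreasing averaging map (COROLLARY, not printed by Federbush; [folklore]) -/

section Infima

variable {X Y : Type*}

/-- [folklore] (the cell's "[reading]" of Federbush's theorem for Bałaban's constrained minimisers in the abelian model,
`t4/T4-LIT2-CITABLE-NE.md` §1.2 (a) — NOT a statement printed by Federbush.)  Let `avg : X → Y` map the fine admissible set `AdmF` into the
coarse admissible set `AdmC` (compatibility of iterated averaging: a fine configuration with prescribed (k+1)-fold average has
a one-step average with the same prescribed k-fold average) and not increase the action, `SC (avg x) ≤ SF x` on `AdmF` (the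
Abelian Stability Theorem).  If `AdmF` is non-empty and `SC` is bounded below on `AdmC`, then
`sInf (SC '' AdmC) ≤ sInf (SF '' AdmF)`: the coarse constrained minimum is below the fine one — for Bałaban's minimal actions,
`inf_k ≤ inf_{k+1}` (monotone in the number of averaging steps; no rate). -/
theorem sInf_coarse_le_sInf_fine (avg : X → Y) (AdmF : Set X) (AdmC : Set Y) (SF : X → ℝ) (SC : Y → ℝ)
    (hmaps : Set.MapsTo avg AdmF AdmC) (hdec : ∀ x ∈ AdmF, SC (avg x) ≤ SF x)
    (hne : AdmF.Nonempty) (hbdd : BddBelow (SC '' AdmC)) :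
    sInf (SC '' AdmC) ≤ sInf (SF '' AdmF) := by
  apply le_csInf (hne.image SF)
  rintro _ ⟨x, hx, rfl⟩
  calc sInf (SC '' AdmC) ≤ SC (avg x) := csInf_le hbdd ⟨avg x, hmaps hx, rfl⟩
    _ ≤ SF x := hdec x hx

end Infima

/-! ## §5 Non-vacuity: Federbush's 2-d illustration p. 323 («A_{∂ABCD} = ¼[A_{∂1}+A_{∂3}+A_{∂7}+A_{∂9}+2(A_{∂2}+A_{∂4}+A_{∂6}+A_{∂8})+4A_{∂5}]»)
has row sum ¼(4·1 + 4·2 + 4) = 4 = 2², as (1.6) requires. -/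

example : (1/4 : ℝ) * (1 + 1 + 1 + 1 + 2 * (1 + 1 + 1 + 1) + 4) = 2 ^ 2 := by norm_num

/-! ## §6 (v1.1) The combinatorial input DERIVED: closed-loop / plaquette averaging (1.3) ⇒ (1.4) with the sum rules (1.5)–(1.6), (2.2)–(2.3)

Federbush I p. 322 (render `…/fed1986/fed1986-cmp107-p004-x2.png`, read as image): *"Let Γ be a closed path in ℒ^r, with
one vertex v. We consider Γ_α, a parallel translation of Γ, in ℒ^s, where the vertex corresponding to v has been translated
to the vertex α, one of the vertices in the superblock. There are 2^{4(s−r)} such Γ_α, one of them the original Γ, viewed in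
the lattice ℒ^s. … We then have A_Γ = (1/2^{4(s−r)}) · Σ_α A_{Γ_α}. (1.3) (Here it is understood that on the left side of the
equation A_Γ is calculated in ℒ^r, and on the right side, each A_{Γ_α} in ℒ^s.) The particular case that Γ is a plaquette is
of greatest interest. If we label plaquettes at level r, by P_i, and plaquettes at level r + 1 by p_j we find from (1.3)
A_{∂P_i} = Σ_j α(i)_j A_{∂p_j} (1.4) for non-negative numbers α(i)_j."*  MODEL (abelian; one step s = r + 1; one coordinate
plane): fine plaquettes in the plane are labelled by base points `w = (u, t)`, `u ∈ P` the in-plane position (`P` any finite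
additive commutative group — the discrete 2-torus in §7), `t ∈ T` the transverse position; the translate of the coarse
plaquette `P_c` to the fine base point `x = (u, t)` consists of the fine plaquettes `(u + s, t)`, `s ∈ S` (the N × N square of
offsets), so that by Stokes `A_{(∂P_c)_x} = Σ_{s∈S} A(u + s, t)`; the block of `c` is the fibre of a block map
`blk : P × T → C` with `K = N^d` points.  §6 proves, for ARBITRARY `blk`, `S`, `K`: (1.3) = Σ_w α(c)_w A(w) with the weights
DEFINED by counting (`loopAverage_eq_sum`), their non-negativity, the row count Σ_w α(c)_w = K⁻¹·#block(c)·#S and the column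
count Σ_c α(c)_w = K⁻¹·#S (`sum_stencilWeight_row/col`), hence — with #block = N^d, #S = N² — the sum rules N² and N^{2−d} and
the Abelian Stability Theorem for the explicit average (`wilsonAction_loopAverage_le`); §7 discharges #block = N^d and #S = N²
for the CONTIGUOUS blocks of the discrete torus (ℤ/nNℤ)^d (`wilsonAction_torusLoopAverage_le`: no hypothesis left but ε > 0).
Federbush's 2-d illustration p. 323 («¼[A_{∂1}+A_{∂3}+A_{∂7}+A_{∂9}+2(A_{∂2}+A_{∂4}+A_{∂6}+A_{∂8})+4A_{∂5}]») is the case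
P = (ℤ/2nℤ)², T = point, N = 2, S = {0,1}² of `stencilWeight`. -/

section Stencil

variable {P T C : Type*} [AddCommGroup P] [DecidableEq P] [Fintype P] [Fintype T] [DecidableEq T]
  [DecidableEq C]

/-- The block (fibre) of the coarse site `c` under the block map `blk` — Federbush's «2⁴ vertices in the block with base
point v» (I p. 322), here for an arbitrary block map. [folklore] -/
def blockOf (blk : P × T → C) (c : C) : Finset (P × T) := univ.filter fun x => blk x = c

/-- The index set of the double sum in (1.3) for Γ = ∂P_c after Stokes: pairs (fine base point `x` in the block of `c`,
in-plane offset `s ∈ S` of a fine plaquette inside the translated coarse plaquette `(∂P_c)_x`). [folklore] -/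
def stencilPairs (blk : P × T → C) (S : Finset P) (c : C) : Finset ((P × T) × P) := blockOf blk c ×ˢ S

/-- The fine plaquette reached from the pair `(x, s)`: in-plane coordinate translated by the offset, transverse coordinate
kept. [folklore] -/
def stencilShift (xs : (P × T) × P) : P × T := (xs.1.1 + xs.2, xs.1.2)

/-- THE ONE-STEP CLOSED-LOOP AVERAGE of an abelian plaquette field over the coarse plaquette based at `c`, Federbush I
(1.3) for Γ = ∂P and s = r + 1 — «A_Γ = (1/2^{4(s−r)}) · Σ_α A_{Γ_α}» over the parallel translates Γ_α of Γ to the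
vertices α of the block — with the translated loop variable written by (abelian) Stokes as the sum of the fine plaquettes
inside: `A′(c) = K⁻¹ Σ_{x ∈ block c} Σ_{s ∈ S} A(x.1 + s, x.2)`, `K` = #block (= N^d), `S` = the N² in-plane offsets.
Federbush identifies this with Bałaban's averaging of CMP 95 (1.8) on closed loops («Plaquette Averaging – Closed Loop
Averaging», I p. 322); that identification is quoted, not re-derived (cf. B7 = CMP 98 (48) p. 25 for the printed
linearised identity). [cite: Federbush1986PhaseCellI, (1.3) p. 322] -/
noncomputable def loopAverage (blk : P × T → C) (S : Finset P) (K : ℝ) (A : P × T → ℝ) (c : C) : ℝ :=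
  K⁻¹ * ∑ x ∈ blockOf blk c, ∑ s ∈ S, A (x.1 + s, x.2)

/-- THE WEIGHTS α(i)_j OF (1.4) — «A_{∂P_i} = Σ_j α(i)_j A_{∂p_j} (1.4) for non-negative numbers α(i)_j» — DEFINED
from (1.3): α(c)_w = K⁻¹ · #{(x, s) : x ∈ block c, s ∈ S, (x.1 + s, x.2) = w}.
[cite: Federbush1986PhaseCellI, (1.4) p. 322] -/
noncomputable def stencilWeight (blk : P × T → C) (S : Finset P) (K : ℝ) (c : C) (w : P × T) : ℝ :=
  K⁻¹ * (((stencilPairs blk S c).filter fun xs => stencilShift xs = w).card : ℝ)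

/-- «for non-negative numbers α(i)_j» (I p. 322): the weights are ≥ 0 when K ≥ 0. [cite: Federbush1986PhaseCellI, (1.4) p. 322] -/
theorem stencilWeight_nonneg (blk : P × T → C) (S : Finset P) {K : ℝ} (hK : 0 ≤ K) (c : C) (w : P × T) :
    0 ≤ stencilWeight blk S K c w := by
  unfold stencilWeight
  exact mul_nonneg (inv_nonneg.mpr hK) (Nat.cast_nonneg _)

/-- (1.3) ⇒ (1.4), PROVED: the loop average is the weighted sum of the fine plaquette variables with the weights
`stencilWeight` (regroup the double sum of (1.3) by the fine plaquette reached). [cite: Federbush1986PhaseCellI,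
(1.3)–(1.4) p. 322] -/
theorem loopAverage_eq_sum (blk : P × T → C) (S : Finset P) (K : ℝ) (A : P × T → ℝ) (c : C) :
    loopAverage blk S K A c = ∑ w, stencilWeight blk S K c w * A w := by
  unfold loopAverage stencilWeight
  have h1 : ∑ x ∈ blockOf blk c, ∑ s ∈ S, A (x.1 + s, x.2)
      = ∑ xs ∈ stencilPairs blk S c, A (stencilShift xs) := by
    unfold stencilPairs stencilShift
    rw [Finset.sum_product]
  have h2 : ∑ xs ∈ stencilPairs blk S c, A (stencilShift xs)
      = ∑ w, ∑ xs ∈ (stencilPairs blk S c).filter (fun xs => stencilShift xs = w), A (stencilShift xs) := by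
    rw [Finset.sum_fiberwise_of_maps_to (g := stencilShift) (t := (univ : Finset (P × T)))]
    intro xs _; exact mem_univ _
  have h3 : ∀ w, ∑ xs ∈ (stencilPairs blk S c).filter (fun xs => stencilShift xs = w), A (stencilShift xs)
      = (((stencilPairs blk S c).filter fun xs => stencilShift xs = w).card : ℝ) * A w := by
    intro w
    rw [Finset.sum_congr rfl (g := fun _ => A w)]
    · rw [Finset.sum_const, nsmul_eq_mul]
    · intro xs hxs
      rw [(Finset.mem_filter.mp hxs).2]
  rw [h1, h2, Finset.mul_sum]
  refine Finset.sum_congr rfl fun w _ => ?_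
  rw [h3 w, mul_assoc]

/-- ROW SUM, the raw count behind (1.6)/(2.3): Σ_w α(c)_w = K⁻¹ · #block(c) · #S (every pair (x, s) reaches exactly one
fine plaquette). With #block = K = N^d and #S = N² this is «Σ_j α(i)_j = 2²  (1.6)» / «Σ_j α(i)_j = N². (2.3)» — see
`wilsonAction_loopAverage_le`. [cite: Federbush1986PhaseCellI, (1.6) p. 323; Federbush1987PhaseCellIII, (2.3) p. 296] -/
theorem sum_stencilWeight_row (blk : P × T → C) (S : Finset P) (K : ℝ) (c : C) :
    ∑ w, stencilWeight blk S K c w = K⁻¹ * ((blockOf blk c).card * S.card : ℕ) := by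
  unfold stencilWeight
  rw [← Finset.mul_sum]
  congr 1
  rw [← Nat.cast_sum, ← Finset.card_eq_sum_card_fiberwise (fun xs _ => mem_univ (stencilShift xs))]
  unfold stencilPairs
  rw [Finset.card_product]

/-- For a fixed fine plaquette `w`, the pairs (x, s), s ∈ S, translated onto `w` are in bijection with `S` (for each
offset s exactly one base point, (w.1 − s, w.2), works) — the counting fact behind the column sum (1.5)/(2.2). [folklore] -/
theorem card_pairs_shift_eq (S : Finset P) (w : P × T) :
    (((univ : Finset (P × T)) ×ˢ S).filter fun xs => stencilShift xs = w).card = S.card := by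
  refine Finset.card_bij' (fun xs _ => xs.2) (fun s _ => ((w.1 - s, w.2), s)) ?_ ?_ ?_ ?_
  · intro xs hxs
    exact (Finset.mem_product.mp (Finset.mem_filter.mp hxs).1).2
  · intro s hs
    refine Finset.mem_filter.mpr ⟨Finset.mem_product.mpr ⟨Finset.mem_univ _, hs⟩, ?_⟩
    simp [stencilShift]
  · intro xs hxs
    obtain ⟨-, hw⟩ := Finset.mem_filter.mp hxs
    rcases xs with ⟨⟨u, t⟩, s⟩
    simp only [stencilShift] at hw
    subst hw
    simp
  · intro s _
    rfl

/-- COLUMN SUM, the raw count behind (1.5)/(2.2): Σ_c α(c)_w = K⁻¹ · #S — the blocks partition the fine lattice, so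
summing over the coarse plaquettes removes the block condition, and `card_pairs_shift_eq` counts the rest. With K = N^d,
#S = N² this is «Σ_i α(i)_j = 1/2²  (1.5)» (d = 4, N = 2) / «Σ_i α(i)_j = 1/N²  (2.2) … In d dimensions 1/N² in (2.2)
would be replaced by 1/N^{d−2}» — see `wilsonAction_loopAverage_le`. [cite: Federbush1986PhaseCellI, (1.5) p. 323;
Federbush1987PhaseCellIII, (2.2) p. 296] -/
theorem sum_stencilWeight_col [Fintype C] (blk : P × T → C) (S : Finset P) (K : ℝ) (w : P × T) :
    ∑ c, stencilWeight blk S K c w = K⁻¹ * (S.card : ℕ) := by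
  unfold stencilWeight
  rw [← Finset.mul_sum]
  congr 1
  rw [← Nat.cast_sum]
  congr 1
  -- the blocks partition the fine lattice
  have hfib : ∀ c, ((stencilPairs blk S c).filter fun xs => stencilShift xs = w)
      = ((((univ : Finset (P × T)) ×ˢ S).filter fun xs => stencilShift xs = w).filter fun xs => blk xs.1 = c) := by
    intro c
    ext xs
    simp only [stencilPairs, blockOf, mem_filter, mem_product, mem_univ, true_and]
    tauto
  simp_rw [hfib]
  rw [← Finset.card_eq_sum_card_fiberwise (fun xs _ => mem_univ (blk xs.1)), card_pairs_shift_eq]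

end Stencil

section Corollary

variable {P T C : Type*} [AddCommGroup P] [DecidableEq P] [Fintype P] [Fintype T] [DecidableEq T]
  [Fintype C] [DecidableEq C]

/-- FEDERBUSH'S ABELIAN STABILITY THEOREM FOR THE EXPLICIT ONE-STEP LOOP AVERAGE (1.3), per coordinate plane, every
dimension `d`: if every block has `N^d` fine base points and `S` consists of `N²` in-plane offsets, then the weights DEFINED by
(1.3)/(1.4) are non-negative with row sums `= N²` ((1.6)/(2.3)) and column sums `= N^{2−d}` ((1.5)/(2.2)), so §2's
`wilsonAction_coarse_le_fine` applies and `S_{Nε}(loop average of A) ≤ S_ε(A)` — «averaging decreases the action» with the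
combinatorial input (1.4)–(1.6) now DERIVED rather than assumed (closing the scope caveat of v1's header for the abelian
Stokes form of the average). The d-dimensional action is the sum of the per-plane actions over the d(d−1)/2 coordinate planes,
in each of which this applies. [cite: Federbush1986PhaseCellI, 'Abelian Stability Theorem' (0.12) p. 321, (1.3)–(1.9)
pp. 322–323; Federbush1987PhaseCellIII, §2 (2.1)–(2.5) p. 296] -/
theorem wilsonAction_loopAverage_le (d : ℕ) {N : ℕ} (hN : 0 < N) {ε : ℝ} (hε : 0 < ε)
    (blk : P × T → C) (S : Finset P) (hblk : ∀ c, (blockOf blk c).card = N ^ d) (hS : S.card = N ^ 2)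
    (A : P × T → ℝ) :
    wilsonActionAbelian d ((N : ℝ) * ε) (loopAverage blk S ((N : ℝ) ^ d) A) ≤ wilsonActionAbelian d ε A := by
  have hNr : (0 : ℝ) < N := by exact_mod_cast hN
  have hNne : (N : ℝ) ≠ 0 := hNr.ne'
  have hKne : ((N : ℝ) ^ d) ≠ 0 := pow_ne_zero _ hNne
  have hfun : loopAverage blk S ((N : ℝ) ^ d) A = fun c => ∑ w, stencilWeight blk S ((N : ℝ) ^ d) c w * A w := by
    funext c; exact loopAverage_eq_sum blk S _ A c
  rw [hfun]
  refine wilsonAction_coarse_le_fine d hNr hε (stencilWeight blk S ((N : ℝ) ^ d)) A ?_ ?_ ?_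
  · intro c w; exact stencilWeight_nonneg blk S (pow_nonneg hNr.le _) c w
  · intro c
    rw [sum_stencilWeight_row, hblk c, hS]
    push_cast
    rw [inv_mul_cancel_left₀ hKne]
  · intro w
    rw [sum_stencilWeight_col, hS]
    push_cast
    rw [show (2 : ℤ) - (d : ℤ) = ((2 : ℕ) : ℤ) - ((d : ℕ) : ℤ) by norm_num, zpow_sub₀ hNne, zpow_natCast,
      zpow_natCast, div_eq_inv_mul]

end Corollary

/-! ## §7 (v1.1) The standard contiguous blocks of the discrete torus: #block = N^d and #S = N² DISCHARGED -/

section TorusBlocks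

/-- On the discrete circle `Fin (n * N)` the CONTIGUOUS block `{Ny, Ny + 1, …, Ny + N − 1}` of the coarse point `y : Fin n`
— the fibre of `Fin.divNat` (x ↦ x / N) — is in bijection with `Fin N` (via `finProdFinEquiv`). [folklore] -/
theorem card_filter_divNat (n N : ℕ) (y : Fin n) :
    ((univ : Finset (Fin (n * N))).filter fun x => x.divNat = y).card = (univ : Finset (Fin N)).card := by
  refine Finset.card_bij' (fun x _ => x.modNat) (fun r _ => finProdFinEquiv (y, r)) ?_ ?_ ?_ ?_
  · intro x _; exact mem_univ _
  · intro r _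
    refine mem_filter.mpr ⟨mem_univ _, ?_⟩
    have h := finProdFinEquiv.symm_apply_apply (y, r)
    rw [finProdFinEquiv_symm_apply] at h
    exact (Prod.mk.inj h).1
  · intro x hx
    have hy := (mem_filter.mp hx).2
    have h := finProdFinEquiv.apply_symm_apply x
    rw [finProdFinEquiv_symm_apply, hy] at h
    exact h
  · intro r _
    have h := finProdFinEquiv.symm_apply_apply (y, r)
    rw [finProdFinEquiv_symm_apply] at h
    exact (Prod.mk.inj h).2

/-- … hence has exactly `N` points. [folklore] -/
theorem card_filter_divNat' (n N : ℕ) (y : Fin n) :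
    ((univ : Finset (Fin (n * N))).filter fun x => x.divNat = y).card = N := by
  rw [card_filter_divNat, Finset.card_univ, Fintype.card_fin]

/-- Base points of the fine plaquettes lying in a fixed coordinate plane of the discrete d-torus (ℤ/nNℤ)^d, d = k + 2,
written as (in-plane pair) × (transverse k-tuple). [folklore] -/
abbrev TorusFineSite (n N k : ℕ) := (Fin (n * N) × Fin (n * N)) × (Fin k → Fin (n * N))
/-- The corresponding coarse sites of (ℤ/nℤ)^d. [folklore] -/
abbrev TorusCoarseSite (n k : ℕ) := (Fin n × Fin n) × (Fin k → Fin n)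

/-- The CONTIGUOUS block map of the torus, every coordinate x ↦ x / N (blocks = cubes of side N; Federbush's N = 2, d = 4:
«in ℒ^{r+1} there are 2⁴ vertices in the block with base point v», I p. 322). [folklore] -/
def torusBlock (n N k : ℕ) (x : TorusFineSite n N k) : TorusCoarseSite n k :=
  ((x.1.1.divNat, x.1.2.divNat), fun i => (x.2 i).divNat)

/-- Every contiguous block of the d-torus has exactly `N^d` fine points (d = k + 2) — the hypothesis `hblk` of
`wilsonAction_loopAverage_le`, DISCHARGED for the standard blocks. [folklore] -/
theorem card_block_torusBlock (n N k : ℕ) (c : TorusCoarseSite n k) :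
    ((univ : Finset (TorusFineSite n N k)).filter fun x => torusBlock n N k x = c).card = N ^ (k + 2) := by
  classical
  set F : Fin n → Finset (Fin (n * N)) := fun y => univ.filter fun x => x.divNat = y with hF
  have hset : ((univ : Finset (TorusFineSite n N k)).filter fun x => torusBlock n N k x = c)
      = ((F c.1.1 ×ˢ F c.1.2) ×ˢ Fintype.piFinset fun i => F (c.2 i)) := by
    ext ⟨⟨u₁, u₂⟩, t⟩
    simp only [torusBlock, mem_filter, mem_univ, true_and, mem_product, Fintype.mem_piFinset, hF,
      Prod.ext_iff, funext_iff]
  rw [hset, card_product, card_product, Fintype.card_piFinset]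
  simp only [hF, card_filter_divNat']
  rw [Finset.prod_const, Finset.card_univ, Fintype.card_fin]
  ring

/-- The `N × N` square of in-plane offsets `{0, …, N−1}²` — the base points, relative to the translate's corner, of the N² fine
plaquettes inside a translated coarse plaquette — embedded in the fine torus coordinates (needs `1 ≤ n`). [folklore] -/
def torusSquareOffsets (n N : ℕ) [NeZero n] : Finset (Fin (n * N) × Fin (n * N)) :=
  (univ : Finset (Fin N × Fin N)).map
    ⟨fun ab => (Fin.castLE (Nat.le_mul_of_pos_left N (NeZero.pos n)) ab.1,
        Fin.castLE (Nat.le_mul_of_pos_left N (NeZero.pos n)) ab.2),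
      fun a b h => by
        simp only [Prod.mk.injEq, Fin.castLE_inj] at h
        exact Prod.ext h.1 h.2⟩

/-- … it has `N²` elements — the hypothesis `hS` of `wilsonAction_loopAverage_le`, DISCHARGED. [folklore] -/
theorem card_torusSquareOffsets (n N : ℕ) [NeZero n] : (torusSquareOffsets n N).card = N ^ 2 := by
  rw [torusSquareOffsets, card_map, Finset.card_univ, Fintype.card_prod, Fintype.card_fin, sq]

/-- FEDERBUSH'S ABELIAN STABILITY THEOREM FOR THE EXPLICIT CONTIGUOUS-BLOCK LOOP AVERAGE ON THE DISCRETE TORUS — no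
hypothesis left except positivity of the spacing: dimension `d = k + 2 ≥ 2`, block side `N ≥ 1`, any torus of `n^d` coarse
sites (`n ≥ 1`), coarse spacing `Nε`, fine spacing `ε`, per coordinate plane: `S_{Nε}(loop average (1.3) of A) ≤ S_ε(A)`.
(Federbush: d = 4, N = 2, lattices (2^{−r}ℤ)⁴; III: block N⁴, «In d dimensions …».) [cite: Federbush1986PhaseCellI,
'Abelian Stability Theorem' (0.12) p. 321, (1.3)–(1.9) pp. 322–323; Federbush1987PhaseCellIII, §2 (2.1)–(2.5) p. 296] -/
theorem wilsonAction_torusLoopAverage_le (n N k : ℕ) [NeZero n] [NeZero N] {ε : ℝ} (hε : 0 < ε)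
    (A : TorusFineSite n N k → ℝ) :
    wilsonActionAbelian (k + 2) ((N : ℝ) * ε)
        (loopAverage (torusBlock n N k) (torusSquareOffsets n N) ((N : ℝ) ^ (k + 2)) A)
      ≤ wilsonActionAbelian (k + 2) ε A :=
  wilsonAction_loopAverage_le (k + 2) (NeZero.pos N) hε (torusBlock n N k) (torusSquareOffsets n N)
    (card_block_torusBlock n N k) (card_torusSquareOffsets n N) A

end TorusBlocks

/-! ## §8 (v1.2) The B5 / BIJ85 normalisation: the CURL HALF of the k-uniform coercivity of the variational effective
gauge action, with the sharp constant γ₀ = 1 — what «(see also [6I, 8])» (BIJ85 p. 325) refers to under [8]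

THE PRINTED CONTEXT (published literature OUTSIDE the series under audit, read as page images by this seat — renders
`HOME/t4/b2b-balaban-t4-lit2/renders/bij1985/1985-cmp97-bij-higgs-minimizers-p005/p006/p011/p012/p013/p027-x2.png`; and ONE
manuscript of the series, quoted for a DEFINITION only).  T. Bałaban, J. Imbrie, A. Jaffe, *Renormalization of the Higgs model:
minimizers, propagators and the stability of mean field theory*, Commun. Math. Phys. **97** (1985) 299–329
[BalabanImbrieJaffe1985] («BIJ85»): p. 304 «(QA)_{b′} = L^{−(d+1)} Σ_{x∈B(b′_−)} Σ_{b∈Γ_{xx′}} A_b, (2.13) where Γ_{xx′} is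
the special contour from x to x′ and xx′ is the parallel transport of the bond b′ to start at x.»; p. 309 «The averaging
operator Q_k is the k-fold composition of the 1-step averaging operators Q for bond variables, Q_k = (Q)^k. It follows that Q_k
is given by the formula (2.13), where L is replaced by L^k.»; pp. 309–310 «Another aspect of the action S_G(A) = ½‖∂A‖² concerns
what configurations minimize S_G(A) subject to the constraints of a gauge condition and a condition that the average field Q_kA
equals a given value B. We introduce a transformation H_{k,Ax} which maps B into such a minimizing configuration for axial gauge,
and we call H_{k,Ax} the axial gauge minimizer. … Note that by definition Q_kH_{k,Ax}B = B. (4.1.5)»; p. 310 «Using that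
representation we also establish a uniform, positive lower bound 0 < c ≤ σ_k. (4.2.3)»; p. 311 «⟨∂B, σ_k∂B⟩ = ⟨B, Δ_kB⟩,
(4.3.1) which defines an action Δ_k. To give a functional integral representation for Δ_k, we note that exp(−½⟨∂B, σ_k∂B⟩) =
Z^{−1}_{k,Ax}∫𝒟Aδ(Q_kA)δ_{k,Ax}(A) exp(−½‖∂A − Q^{e*}_k∂B‖²) = Z^{−1}_{k,Ax}∫𝒟Aδ(Q_kA − B)δ_{k,Ax}(A) exp(−½‖∂A‖²) =
exp(−½⟨B, Δ_kB⟩). (4.3.2)»; p. 325 «… which is bounded below by ε‖∂B‖² (see also [6I, 8]). This completes the proof of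
Theorem 7.1.1.», with p. 329 «8. Federbush, P.: A phase cell approach to Yang-Mills theory. I. Small field modes. University of
Michigan preprint» (= [Federbush1986PhaseCellI]) and «6. Bałaban, T.: Propagators and renormalization transformations for
lattice gauge theories. I. Commun. Math. Phys. 95, 17-40 (1984)».  The DEFINITION quoted from the series (B5 = [6I] =
[Balaban1984PropagatorsI] p. 29, as transcribed in the tree headers `Balaban1983to89/B5Action165Lagrange`,
`…/T4GaugeActionRate`): «H_kB is a minimum of ½⟨∂A,∂A⟩ on the hyperplane {A : Q_kA = B, R∂*A = 0}», «The action Δ_k is thus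
defined by ⟨B, Δ_kB⟩ = ⟨∂H_kB, ∂H_kB⟩. (1.65)», and the CLAIM (1.67) «γ₀⟨∂₁B, ∂₁B⟩ ≤ ⟨B, Δ_kB⟩ ≤ γ₁⟨∂₁B, ∂₁B⟩» with «positive
constants γ₀, γ₁ dependent on d only» — NOT used as a hypothesis anywhere; §8 gives its LOWER half an independent proof route.

THE READING (this seat's; elementary; `t4/T4-LIT2-CITABLE-NE.md` §8.8).  (i) Δ_k is VARIATIONAL: ⟨B, Δ_kB⟩ = ‖∂H_kB‖²_η with
Q_kH_kB = B ((1.65) + the p. 29 sentence; BIJ85 (4.3.2) with (4.1.3)–(4.1.5)), so a LOWER bound for ‖∂A‖²_η valid for EVERY A of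
the fibre {Q_kA = B} bounds ⟨B, Δ_kB⟩ below — no gauge condition is needed for this direction.  (ii) For ABELIAN bond fields
Bałaban's Q_k ((2.13) with L → L^k = N = η⁻¹) is linear and, by abelian Stokes and the telescoping of the four contour averages
around a unit plaquette, the unit-lattice plaquette variable of the averaged field is η × (the average over the N^d base points
of the block of the SUM of the N² fine plaquette variables inside the translated unit square) = `η · loopAverage` of §6 applied
to the fine plaquette field F = plaquette sums of A — Federbush I p. 322 'Plaquette Averaging – Closed Loop Averaging' (1.3);
the printed linearised identity is Bałaban CMP 98 (48) p. 25; in the tree, on ℤ^d and in transpose form, it is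
`Balaban1983to89/T4LoopPullback.loopPull_closed` / `pull_rectBdry` (pv25 lineage).  The factor η is the «mean along the contour»
normalisation L^{−(d+1)} of (2.13) against Federbush's sum along the path.  THIS IDENTIFICATION IS QUOTED HERE, NOT RE-DERIVED
for the tree's typed torus operator `B5AveragingTorus.avgKer`.  (iii) B5's norms: ‖∂A‖²_η = Σ_x η^d Σ_{μ<ν} |(∂A)_{μν}(x)|² with
(∂A)_{μν} = F/η, i.e. ‖∂A‖²_η = η^{d−2} Σ_p F(p)², and ‖∂₁B‖² = Σ_P G(P)² for the unit-lattice plaquette field G.  (iv) §7 with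
fine spacing ε = η and coarse spacing Nη = 1 gives Σ_P (loopAverage F)(P)² ≤ η^{d−4} Σ_p F(p)², hence — THIS SECTION —
`Σ_P (η · loopAverage F)(P)² ≤ η^{d−2} Σ_p F(p)²`, which under (ii)–(iii) READS ‖∂₁(Q_kA)‖² ≤ ‖∂A‖²_η for every A, and under
(i) READS ⟨B, Δ_kB⟩ ≥ ‖∂₁B‖²: the LOWER HALF OF (1.67) WITH γ₀ = 1 and the curl half of BIJ85 (4.2.3)/(7.1.1) with ε = 1 — every
d ≥ 2, every number of steps, every torus, U = 1 abelian, Fourier-free (Jensen + counting).  γ₀ = 1 is SHARP (the p. 325 / (1.66)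
momentum weight tends to 1 as p′ → 0).  HONEST SCOPE: proved here are the plaquette-field inequalities and two lines of order
theory (`le_csInf_fibre`, `le_of_rightInverse`); (i) and (ii) are identifications of the printed objects with the arguments of
these theorems, stated in the docstrings, not kernel facts about `B5AveragingTorus`/`B5Action165Lagrange`; nothing here is an
η-RATE (the cell's NE2 proper stays NEW), nothing is non-abelian, NOT summit progress. -/

section B5Normalisation

variable {P T C : Type*} [AddCommGroup P] [DecidableEq P] [Fintype P] [Fintype T] [DecidableEq T]
  [Fintype C] [DecidableEq C]

/-- B5-NORMALISED ABELIAN STABILITY, any block map with `N^d`-point blocks and `N²` offsets, `N ≥ 1`, `η = N⁻¹`: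
`Σ_c (η · loopAverage F c)² ≤ η^{d−2} · Σ_w F(w)²` — i.e. (reading (ii)–(iii) of the §8 header) ‖∂₁(Q_kA)‖² ≤ ‖∂A‖²_η for
Bałaban's linear average of an abelian bond field, every `d`.  Proof: §6 `wilsonAction_loopAverage_le` at fine spacing
`ε = N⁻¹`, coarse spacing `N·N⁻¹ = 1`, multiplied by `η²`.
[cite: Federbush1986PhaseCellI, 'Abelian Stability Theorem' (0.12) p. 321, (1.3)–(1.9) pp. 322–323;
BalabanImbrieJaffe1985, (2.13) p. 304, p. 309 «Q_k = (Q)^k … (2.13), where L is replaced by L^k»] -/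
theorem sum_sq_meanLoopAverage_le (d : ℕ) {N : ℕ} (hN : 0 < N)
    (blk : P × T → C) (S : Finset P) (hblk : ∀ c, (blockOf blk c).card = N ^ d) (hS : S.card = N ^ 2)
    (F : P × T → ℝ) :
    ∑ c, ((N : ℝ)⁻¹ * loopAverage blk S ((N : ℝ) ^ d) F c) ^ 2
      ≤ ((N : ℝ)⁻¹) ^ ((d : ℤ) - 2) * ∑ w, F w ^ 2 := by
  have hNr : (0 : ℝ) < N := by exact_mod_cast hN
  have hNne : (N : ℝ) ≠ 0 := hNr.ne'
  have hη : (0 : ℝ) < (N : ℝ)⁻¹ := inv_pos.mpr hNr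
  have hηne : (N : ℝ)⁻¹ ≠ 0 := hη.ne'
  have h := wilsonAction_loopAverage_le d hN hη blk S hblk hS F
  unfold wilsonActionAbelian at h
  rw [mul_inv_cancel₀ hNne, one_zpow, one_mul] at h
  -- h : Σ_c (loopAverage … F c)² ≤ (N⁻¹)^{d−4} · Σ_w F w²
  have key : ∑ c, ((N : ℝ)⁻¹ * loopAverage blk S ((N : ℝ) ^ d) F c) ^ 2
      = (N : ℝ)⁻¹ ^ 2 * ∑ c, (loopAverage blk S ((N : ℝ) ^ d) F c) ^ 2 := by
    rw [Finset.mul_sum]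
    exact Finset.sum_congr rfl fun c _ => by rw [mul_pow]
  have hexp : (N : ℝ)⁻¹ ^ 2 * (N : ℝ)⁻¹ ^ ((d : ℤ) - 4) = (N : ℝ)⁻¹ ^ ((d : ℤ) - 2) := by
    rw [← zpow_natCast, ← zpow_add₀ hηne]
    congr 1
    push_cast
    ring
  calc ∑ c, ((N : ℝ)⁻¹ * loopAverage blk S ((N : ℝ) ^ d) F c) ^ 2
      = (N : ℝ)⁻¹ ^ 2 * ∑ c, (loopAverage blk S ((N : ℝ) ^ d) F c) ^ 2 := key
    _ ≤ (N : ℝ)⁻¹ ^ 2 * ((N : ℝ)⁻¹ ^ ((d : ℤ) - 4) * ∑ w, F w ^ 2) :=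
        mul_le_mul_of_nonneg_left h (by positivity)
    _ = (N : ℝ)⁻¹ ^ ((d : ℤ) - 2) * ∑ w, F w ^ 2 := by rw [← mul_assoc, hexp]

/-- THE CURL HALF, fibre form (reading (i) of the §8 header: BIJ85 (4.3.2) / B5 (1.65) make `⟨B, Δ_kB⟩` the minimum of the
fine action over the fibre `{Q_kA = B}`): for every unit-lattice plaquette field `G` and every NON-EMPTY family `𝔉` of fine
plaquette fields all of whose `η`-normalised loop averages equal `G`, `Σ_c G(c)² ≤ inf_{F ∈ 𝔉} η^{d−2} Σ_w F(w)²` —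
«γ₀⟨∂₁B, ∂₁B⟩ ≤ ⟨B, Δ_kB⟩» with γ₀ = 1, for the variational Δ_k, abelian, every `d`, every block map with `N^d`-point
blocks.  [cite: Federbush1986PhaseCellI, 'Abelian Stability Theorem' (0.12) p. 321; BalabanImbrieJaffe1985, (4.3.1)–(4.3.2)
p. 311, (4.1.5) p. 310, Thm 7.1.1 p. 321 / p. 325 «bounded below by ε‖∂B‖² (see also [6I, 8])»] -/
theorem sum_sq_le_csInf_fibre (d : ℕ) {N : ℕ} (hN : 0 < N)
    (blk : P × T → C) (S : Finset P) (hblk : ∀ c, (blockOf blk c).card = N ^ d) (hS : S.card = N ^ 2)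
    (G : C → ℝ) (𝔉 : Set (P × T → ℝ)) (hne : 𝔉.Nonempty)
    (hfib : ∀ F ∈ 𝔉, ∀ c, (N : ℝ)⁻¹ * loopAverage blk S ((N : ℝ) ^ d) F c = G c) :
    ∑ c, G c ^ 2 ≤ sInf ((fun F : P × T → ℝ => ((N : ℝ)⁻¹) ^ ((d : ℤ) - 2) * ∑ w, F w ^ 2) '' 𝔉) := by
  apply le_csInf (hne.image _)
  rintro _ ⟨F, hF, rfl⟩
  calc ∑ c, G c ^ 2 = ∑ c, ((N : ℝ)⁻¹ * loopAverage blk S ((N : ℝ) ^ d) F c) ^ 2 := by simp_rw [hfib F hF]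
    _ ≤ ((N : ℝ)⁻¹) ^ ((d : ℤ) - 2) * ∑ w, F w ^ 2 := sum_sq_meanLoopAverage_le d hN blk S hblk hS F

/-- THE CURL HALF, minimiser form (reading (i): B5 p. 29 «H_kB is a minimum of ½⟨∂A,∂A⟩ on the hyperplane {A : Q_kA = B,
…}», BIJ85 (4.1.5) «Q_kH_{k,Ax}B = B»): for ANY right inverse `H` of the `η`-normalised loop average — any selection of one
fine plaquette field per unit-lattice datum with the prescribed averages, minimising or not — `Σ_c G(c)² ≤ η^{d−2} Σ_w (H G)(w)²`;
with `H` = the plaquette sums of Bałaban's minimiser this READS ⟨B, Δ_kB⟩ = ‖∂H_kB‖²_η ≥ ‖∂₁B‖², i.e. (1.67) with γ₀ = 1.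
[cite: Federbush1986PhaseCellI, 'Abelian Stability Theorem' (0.12) p. 321; BalabanImbrieJaffe1985, (4.1.5) p. 310,
(4.3.1) p. 311] -/
theorem sum_sq_le_of_rightInverse (d : ℕ) {N : ℕ} (hN : 0 < N)
    (blk : P × T → C) (S : Finset P) (hblk : ∀ c, (blockOf blk c).card = N ^ d) (hS : S.card = N ^ 2)
    (H : (C → ℝ) → (P × T → ℝ))
    (hH : ∀ (G : C → ℝ) (c : C), (N : ℝ)⁻¹ * loopAverage blk S ((N : ℝ) ^ d) (H G) c = G c) (G : C → ℝ) :
    ∑ c, G c ^ 2 ≤ ((N : ℝ)⁻¹) ^ ((d : ℤ) - 2) * ∑ w, (H G) w ^ 2 := by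
  calc ∑ c, G c ^ 2 = ∑ c, ((N : ℝ)⁻¹ * loopAverage blk S ((N : ℝ) ^ d) (H G) c) ^ 2 := by simp_rw [hH G]
    _ ≤ ((N : ℝ)⁻¹) ^ ((d : ℤ) - 2) * ∑ w, (H G) w ^ 2 := sum_sq_meanLoopAverage_le d hN blk S hblk hS (H G)

end B5Normalisation

section B5NormalisationTorus

/-- B5-NORMALISED ABELIAN STABILITY ON THE DISCRETE TORUS (ℤ/nNℤ)^d, d = k + 2, contiguous blocks of side N = η⁻¹, NO
hypothesis: `Σ_c (η · loopAverage F c)² ≤ η^{d−2} Σ_w F(w)²` per coordinate plane — reading: ‖∂₁(Q_kA)‖² ≤ ‖∂A‖²_η for Bałaban's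
`Q_k` = (2.13) with L → L^k = N (BIJ85 p. 309) on abelian bond fields, hence the curl half ⟨B, Δ_kB⟩ ≥ ‖∂₁B‖² of the k-uniform
coercivity (B5 (1.67) lower bound with γ₀ = 1; BIJ85 (4.2.3) / Thm 7.1.1 curl half with ε = 1) by Federbush's route [8].
[cite: Federbush1986PhaseCellI, 'Abelian Stability Theorem' (0.12) p. 321, (1.3)–(1.9) pp. 322–323; Federbush1987PhaseCellIII,
§2 (2.1)–(2.5) p. 296; BalabanImbrieJaffe1985, (2.13) p. 304, (4.1.5) p. 310, (4.3.1)–(4.3.2) p. 311, p. 325] -/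
theorem sum_sq_meanTorusLoopAverage_le (n N k : ℕ) [NeZero n] [NeZero N] (F : TorusFineSite n N k → ℝ) :
    ∑ c, ((N : ℝ)⁻¹ * loopAverage (torusBlock n N k) (torusSquareOffsets n N) ((N : ℝ) ^ (k + 2)) F c) ^ 2
      ≤ ((N : ℝ)⁻¹) ^ k * ∑ w, F w ^ 2 := by
  have h := sum_sq_meanLoopAverage_le (k + 2) (NeZero.pos N) (torusBlock n N k) (torusSquareOffsets n N)
    (card_block_torusBlock n N k) (card_torusSquareOffsets n N) F
  have hexp : ((N : ℝ)⁻¹) ^ (((k + 2 : ℕ) : ℤ) - 2) = ((N : ℝ)⁻¹) ^ k := by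
    rw [← zpow_natCast]
    congr 1
    push_cast
    ring
  rw [hexp] at h
  exact h

/-- … and its minimiser form on the torus: for ANY right inverse `H` of the `η`-normalised contiguous-block loop average,
`Σ_c G(c)² ≤ η^{d−2} Σ_w (H G)(w)²` (d − 2 = k) — «γ₀⟨∂₁B, ∂₁B⟩ ≤ ⟨B, Δ_kB⟩» with γ₀ = 1 for the variational abelian Δ_k.
[cite: Federbush1986PhaseCellI, 'Abelian Stability Theorem' (0.12) p. 321; BalabanImbrieJaffe1985, (4.1.5) p. 310,
(4.3.1)–(4.3.2) p. 311] -/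
theorem torus_sum_sq_le_of_rightInverse (n N k : ℕ) [NeZero n] [NeZero N]
    (H : (TorusCoarseSite n k → ℝ) → (TorusFineSite n N k → ℝ))
    (hH : ∀ (G : TorusCoarseSite n k → ℝ) (c : TorusCoarseSite n k), (N : ℝ)⁻¹ *
      loopAverage (torusBlock n N k) (torusSquareOffsets n N) ((N : ℝ) ^ (k + 2)) (H G) c = G c)
    (G : TorusCoarseSite n k → ℝ) :
    ∑ c, G c ^ 2 ≤ ((N : ℝ)⁻¹) ^ k * ∑ w, (H G) w ^ 2 := by
  calc ∑ c, G c ^ 2 = ∑ c, ((N : ℝ)⁻¹ *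
        loopAverage (torusBlock n N k) (torusSquareOffsets n N) ((N : ℝ) ^ (k + 2)) (H G) c) ^ 2 := by
          simp_rw [hH G]
    _ ≤ ((N : ℝ)⁻¹) ^ k * ∑ w, (H G) w ^ 2 := sum_sq_meanTorusLoopAverage_le n N k (H G)

end B5NormalisationTorus
end Literature.MathematicalPhysics.QuantumFieldTheory.Federbush1986
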